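import Summits.CriticalPhenomena.PercolationContinuityZ3.Theorems.PercNearOneGluingNoHeavyLowerTailSahiOneStepUniformThreshold
import HarnessLib

/-!
# Kahn C5 / Sahi C₃ for every Hamming-threshold first slot under the UNIFORM product measure `Bernoulli(P)^{⊗ι}`

Support file (prover prim-ineq-prove-3 gen 21; `--supports stmt-CriticalPhenomena-4575`; memo
`run/shared/lean/prim/prim-ineq-prove-3/PROOF-2PRIME-UNIFORM.md`).  No definitions, no named facts, no sorries, no `native_decide`.

The citation-ready special case of `sahiE3_threshold_nonneg_of_const` for a CONSTANT density vector `p ≡ P` (`0 < P < 1`; e.g. the uniform measure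
`P = 1/2` of Kahn's question): for every block `F`, every `t` and ALL increasing events `A, B ⊆ 2^ι`,
`0 ≤ E₃(1_{#(F∩ω) ≥ t}, 1_A, 1_B)`; and the `(2′)` half `0 ≤ n(Th_t(F); A, B)` for increasing `F`-determined `A, B`.
-/

noncomputable section

namespace Summit.CriticalPhenomena.PercolationContinuityZ3.Theorems

namespace SahiOneStep

open MeasureTheory
open Literature.Probability.Percolation (DeterminedBy)
open Literature.Probability.LatticeModels (prodBernoulli sahiE3)
open Literature.Probability.Percolation.DecisionTree (ind)
open scoped Classical

variable {ι : Type*} [Fintype ι]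

/-- **The `(2′)` half for every Hamming threshold under a uniform product measure** `p ≡ P ∈ (0,1)`. [this work] -/
theorem osN_threshold_nonneg_uniform (P : unitInterval) (hP0 : 0 < (P : ℝ)) (hP1 : (P : ℝ) < 1) (F : Finset ι) (t : ℕ)
    {A B : Set (Set ι)} (hA : IsUpperSet A) (hB : IsUpperSet B) (hAF : DeterminedBy A (↑F : Set ι))
    (hBF : DeterminedBy B (↑F : Set ι)) :
    0 ≤ osN (fun _ : ι => P) {ω : Set ι | t ≤ (F.filter (· ∈ ω)).card} (ind A) (ind B) :=
  osN_threshold_nonneg_of_const (fun _ : ι => P) hP0 hP1 F (fun _ _ => rfl) t hA hB hAF hBF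

/-- **KAHN C5 / SAHI C₃ FOR EVERY HAMMING-THRESHOLD FIRST SLOT UNDER A UNIFORM PRODUCT MEASURE** `Bernoulli(P)^{⊗ι}`, `0 < P < 1`
(in particular `P = 1/2`): `0 ≤ E₃(1_{#(F∩ω) ≥ t}, 1_A, 1_B)` for every `F`, `t` and all increasing `A, B`. [this work] -/
theorem sahiE3_threshold_nonneg_uniform (P : unitInterval) (hP0 : 0 < (P : ℝ)) (hP1 : (P : ℝ) < 1) (F : Finset ι) (t : ℕ)
    {A B : Set (Set ι)} (hA : IsUpperSet A) (hB : IsUpperSet B) :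
    0 ≤ sahiE3 (prodBernoulli fun _ : ι => P) {ω : Set ι | t ≤ (F.filter (· ∈ ω)).card} A B :=
  sahiE3_threshold_nonneg_of_const (fun _ : ι => P) hP0 hP1 F (fun _ _ => rfl) t hA hB

end SahiOneStep

end Summit.CriticalPhenomena.PercolationContinuityZ3.Theorems
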